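import Mathlib
import Summits.NavierStokesRegularity.NavierStokesRegularity.Theorems.TerminalTraceTypeITraceScarL3TopFluxIntegrable
import Literature.Analysis.FluidPDE.HarmonicProbe

set_option linter.dupNamespace false

/-!
# Route QuarterJolt — crux `NoTerminalJolt` (stmt-NavierStokesRegularity-26463), LEAD line
# `regular_split`: QUANTITATIVE LOCAL ENERGY FLUX BOUND and a DILATED CUT-OFF FAMILY
# (tools for the tightness of the energy at spatial infinity in the frame)

Seat ns-ntj-p1 g5 (LEAD of the crux; `--supports 26463 --as helper`). Purpose: the gap between stub 3
of the line (energy equality at every frame time) and shelf statement stmt-18118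
(`NoFastEnergyConcentration`) is the TIGHTNESS of `|u(t)|²` at spatial infinity as `t ↑ T`
(`QuarterJoltLocalEnergyContinuityOfUI.lean`). Tightness follows from the local energy identity with
dilated cut-offs `χ_R(x) = χ(x/R)` once the time-integrated flux is `O(1/R)`. This file supplies the two
ingredients, for `(u,p)` classical on `[0,T)` with viscosity `ν > 0` and Leray–Hopf on `[0,T]`:

* `NoTerminalJolt.exists_lintegral_flux_le` — a constant `K < ∞` depending only on the solution such
  that for EVERY cut-off `φ ∈ C_c^∞` with `|Δφ| ≤ A`, `‖Dφ‖ ≤ B`: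
  `∫_{(0,T)} |F_φ(t)| dt ≤ (A + B)·K`, `F_φ = ∫ (νΔφ|u|² + Dφ(u)|u|² + 2 p Dφ(u))` — the tree's
  `TypeITraceScarL3.integrableOn_flux_Ioo` (nsreg-C26: Leray–Hopf energy bound, slice-wise Lebesgue
  interpolation `∫|u|³ ≤ c(1 + ∫|∇u|²)`, Tao's pressure gauge with Stein's bound, Young) made
  QUANTITATIVE in the cut-off;
* `NoTerminalJolt.exists_cutoffFamily` — smooth cut-offs `χ_R`, `R > 0`, with `0 ≤ χ_R ≤ 1`,
  `χ_R = 1` on `B̄(0,R)`, `χ_R = 0` off `B(0,2R)`, `|Δχ_R| ≤ A₁/R²`, `‖Dχ_R‖ ≤ B₁/R` (a dilated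
  `ContDiffBump`; Laplacian scaling `laplacian_const_smul_comp_smul`).

HONEST FRAMING: technical lemmas; nothing here proves any crux, stmt-18118 or Navier–Stokes regularity.
[cite: CaffarelliKohnNirenberg1982, §2 (2.5); SereginSverak2002, §3; LeslieShvydkoy2017, §4]
-/

noncomputable section

open MeasureTheory TopologicalSpace Set Function Filter Metric
open _root_.Topology
open scoped Laplacian InnerProductSpace RealInnerProductSpace ENNReal NNReal ContDiff

namespace Summit.NavierStokesRegularity.NavierStokesRegularity.Theorems.NoTerminalJolt

open Literature.Analysis.FluidPDE
open Summit.NavierStokesRegularity.NavierStokesRegularity.Theorems.TypeITraceScarL3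

/-! ### The quantitative flux bound -/

/-- **Quantitative time-integrated flux bound.** For `(u,p)` classical on `[0,T)` with viscosity
`ν > 0`, Leray–Hopf on `[0,T]`, there is `K < ∞` such that for every `φ ∈ C_c^∞(ℝ³)` with
`|Δφ| ≤ A` and `‖Dφ‖ ≤ B` pointwise, `∫⁻_{(0,T)} ‖F_φ(t)‖ₑ dt ≤ (A + B)·K`, where
`F_φ(t) = ∫ (νΔφ|u(t)|² + Dφ(u(t))|u(t)|² + 2 p(t) Dφ(u(t)))` is the local energy flux. Same proof as
`TypeITraceScarL3.integrableOn_flux_Ioo`, keeping track of `A` and `B`: `K = |ν|·C_E·T +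
(1 + 2(C₀+1))·c·(T + ∫₀ᵀ∫|∇u|²)` with the Leray–Hopf energy bound `C_E`, the interpolation constant `c`
and Stein's constant `C₀`. [cite: CaffarelliKohnNirenberg1982, §2 (2.5); SereginSverak2002, §3] -/
theorem exists_lintegral_flux_le {ν T : ℝ} (hν : 0 < ν) (hT : 0 < T)
    {u : ℝ → EuclideanSpace ℝ (Fin 3) → EuclideanSpace ℝ (Fin 3)}
    {p : ℝ → EuclideanSpace ℝ (Fin 3) → ℝ}
    (hcl : IsClassicalNSSolutionOn (Set.Ico 0 T) ν 0 u p) (hLH : IsLerayHopfOn T ν 0 (u 0) u) :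
    ∃ K : ℝ≥0∞, K ≠ ⊤ ∧ ∀ (φ : EuclideanSpace ℝ (Fin 3) → ℝ), ContDiff ℝ ∞ φ →
      HasCompactSupport φ → ∀ (A B : ℝ), (∀ x, |(Δ φ) x| ≤ A) → (∀ x, ‖fderiv ℝ φ x‖ ≤ B) →
      ∫⁻ t in Ioo 0 T, ‖∫ x, (ν * ((Δ φ) x * ‖u t x‖ ^ 2) +
          fderiv ℝ φ x (u t x) * ‖u t x‖ ^ 2 + 2 * (p t x * fderiv ℝ φ x (u t x)))‖ₑ ≤
        (ENNReal.ofReal A + ENNReal.ofReal B) * K := by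
  -- the classical solution on the open time set `(0, T)`
  have hcl' : IsClassicalNSSolutionOn (Ioo 0 T) ν 0 u p :=
    hcl.mono Ioo_subset_Ico_self isOpen_Ioo.uniqueDiffOn
  -- Young's inequality with exponents `3/2` and `3`, constants dropped
  have young : ∀ a b : ℝ, 0 ≤ a → 0 ≤ b → a * b ≤ a ^ (3 / 2 : ℝ) + b ^ 3 := by
    intro a b ha hb
    have hpq : (3 / 2 : ℝ).HolderConjugate 3 := by
      rw [Real.holderConjugate_iff]; norm_num
    have hy := Real.young_inequality_of_nonneg ha hb hpq
    have h3 : b ^ (3 : ℝ) = b ^ (3 : ℕ) := by exact_mod_cast Real.rpow_natCast b 3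
    rw [h3] at hy
    have h1 : 0 ≤ a ^ (3 / 2 : ℝ) := Real.rpow_nonneg ha _
    have h2 : 0 ≤ b ^ 3 := pow_nonneg hb 3
    have e1 : a ^ (3 / 2 : ℝ) / (3 / 2) = (2 / 3) * a ^ (3 / 2 : ℝ) := by ring
    have e2 : b ^ 3 / 3 = (1 / 3) * b ^ 3 := by ring
    rw [e1, e2] at hy
    linarith
  -- the Leray–Hopf data: energy bound, slice-wise `L³` bound, pressure gauge
  obtain ⟨CE, hCE⟩ := hLH.energy_bound
  obtain ⟨c, G, hct, hint, hslice⟩ := SereginSverak2002.exists_ae_lintegral_enorm_pow_three_le hν hLH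
  obtain ⟨hgauge, -⟩ := SereginSverak2002.exists_pressure_gauge_of_classical hν hT hcl hLH
  set C₀ : ℝ≥0∞ := (steinConstThreeHalves : ℝ≥0∞) ^ (3 / 2 : ℝ) with hC₀
  have hC₀t : C₀ ≠ ⊤ := ENNReal.rpow_ne_top_of_nonneg (by norm_num) ENNReal.coe_ne_top
  -- the solution constants (the volume and the total dissipation are generalised to opaque
  -- variables, so that no definitional unfolding of `volume` is ever attempted)
  obtain ⟨V, hV⟩ : ∃ V : ℝ≥0∞, volume (Ioo (0 : ℝ) T) = V := ⟨_, rfl⟩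
  have hVt : V ≠ ⊤ := by rw [← hV, Real.volume_Ioo]; exact ENNReal.ofReal_ne_top
  obtain ⟨DD, hDD⟩ : ∃ DD : ℝ≥0∞,
      (∫⁻ t in Ioo 0 T, ∫⁻ x, ENNReal.ofReal (frobeniusNormSq (G t x))) = DD := ⟨_, rfl⟩
  have hDDt : DD ≠ ⊤ := by rw [← hDD]; exact hint.ne
  set K₁ : ℝ≥0∞ := ENNReal.ofReal |ν| * CE with hK₁
  set K₂ : ℝ≥0∞ := (1 + 2 * (C₀ + 1)) * c with hK₂
  have hK₁t : K₁ ≠ ⊤ := ENNReal.mul_ne_top ENNReal.ofReal_ne_top ENNReal.coe_ne_top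
  have hK₂t : K₂ ≠ ⊤ := by
    refine ENNReal.mul_ne_top (ENNReal.add_ne_top.2 ⟨ENNReal.one_ne_top, ?_⟩) hct
    exact ENNReal.mul_ne_top (by norm_num) (ENNReal.add_ne_top.2 ⟨hC₀t, ENNReal.one_ne_top⟩)
  have hKt : K₁ * V + K₂ * (V + DD) ≠ ⊤ := ENNReal.add_ne_top.2
    ⟨ENNReal.mul_ne_top hK₁t hVt, ENNReal.mul_ne_top hK₂t (ENNReal.add_ne_top.2 ⟨hVt, hDDt⟩)⟩
  refine ⟨K₁ * V + K₂ * (V + DD), hKt, fun φ hφ hφc A B hA hB => ?_⟩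
  -- the cut-off data
  have hφ2 : ContDiff ℝ 2 φ := hφ.of_le (by norm_cast)
  have hφ1 : ContDiff ℝ 1 φ := hφ.of_le (by norm_cast)
  have hΔφ : Continuous (Δ φ) := continuous_laplacian hφ2
  have hDφ : Continuous (fderiv ℝ φ) := hφ1.continuous_fderiv one_ne_zero
  have hA0 : 0 ≤ A := (abs_nonneg _).trans (hA 0)
  have hB0 : 0 ≤ B := (norm_nonneg _).trans (hB 0)
  -- the pointwise-in-time bound, for a.e. `t ∈ (0, T)`
  have hpt : ∀ᵐ t ∂(volume.restrict (Ioo 0 T)),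
      ‖∫ x, (ν * ((Δ φ) x * ‖u t x‖ ^ 2) + fderiv ℝ φ x (u t x) * ‖u t x‖ ^ 2 +
        2 * (p t x * fderiv ℝ φ x (u t x)))‖ₑ ≤
      ENNReal.ofReal A * K₁ +
        ENNReal.ofReal B * (K₂ * (1 + ∫⁻ x, ENNReal.ofReal (frobeniusNormSq (G t x)))) := by
    filter_upwards [hCE, hslice, hgauge, ae_restrict_mem measurableSet_Ioo] with t hE h3 hg htI
    set D : ℝ≥0∞ := ∫⁻ x, ENNReal.ofReal (frobeniusNormSq (G t x)) with hDdef
    set c₀ : ℝ := p t 0 - normalisedPressure (u t) 0 with hc₀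
    have hu : Continuous (u t) := (hcl.contDiff_velocity ⟨htI.1.le, htI.2⟩).continuous
    have hpc : Continuous (p t) := (hcl.contDiff_pressure ⟨htI.1.le, htI.2⟩).continuous
    -- the three slice quantities, in `ℝ≥0∞`
    have hU : ∫⁻ x, ‖u t x‖ₑ ^ (3 : ℕ) ≤ c * (1 + D) := h3
    have hE2 : ∫⁻ x, ‖u t x‖ₑ ^ 2 ≤ CE := by simpa [eEnergy] using hE
    have hQ : ∫⁻ x, ‖p t x - c₀‖ₑ ^ (3 / 2 : ℝ) ≤ C₀ * (c * (1 + D)) := by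
      have hsm : ContDiff ℝ (⊤ : ℕ∞) (u t) := hcl.contDiff_velocity ⟨htI.1.le, htI.2⟩
      have hL2 : Integrable fun y => ‖u t y‖ ^ 2 :=
        (hLH.memLp t ⟨htI.1.le, htI.2.le⟩).integrable_norm_pow two_ne_zero
      calc ∫⁻ x, ‖p t x - c₀‖ₑ ^ (3 / 2 : ℝ)
          = ∫⁻ x, ‖normalisedPressure (u t) x‖ₑ ^ (3 / 2 : ℝ) := by simp only [hg]
        _ ≤ C₀ * ∫⁻ x, ‖u t x‖ₑ ^ (3 : ℕ) :=
            SereginSverak2002.lintegral_normalisedPressure_rpow_le hsm hL2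
        _ ≤ C₀ * (c * (1 + D)) := by gcongr
    -- (i) the Laplacian term
    have b1 : ENNReal.ofReal (|ν| * ∫ x, |(Δ φ) x| * ‖u t x‖ ^ 2) ≤ ENNReal.ofReal A * K₁ := by
      rw [ENNReal.ofReal_mul (abs_nonneg ν), hK₁, ← mul_assoc, mul_comm (ENNReal.ofReal A),
        mul_assoc]
      gcongr
      calc ENNReal.ofReal (∫ x, |(Δ φ) x| * ‖u t x‖ ^ 2)
          ≤ ∫⁻ x, ENNReal.ofReal (|(Δ φ) x| * ‖u t x‖ ^ 2) :=
            ofReal_integral_le_lintegral_ofReal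
              (fun x => mul_nonneg (abs_nonneg _) (pow_nonneg (norm_nonneg _) _))
              ((continuous_abs.comp hΔφ).mul (hu.norm.pow 2)).aestronglyMeasurable
        _ ≤ ∫⁻ x, ENNReal.ofReal A * ‖u t x‖ₑ ^ 2 := by
            refine lintegral_mono fun x => ?_
            rw [ENNReal.ofReal_mul (abs_nonneg _), ← ofReal_norm,
              ← ENNReal.ofReal_pow (norm_nonneg _)]
            exact mul_le_mul' (ENNReal.ofReal_le_ofReal (hA x)) le_rfl
        _ = ENNReal.ofReal A * ∫⁻ x, ‖u t x‖ₑ ^ 2 :=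
            lintegral_const_mul' _ _ ENNReal.ofReal_ne_top
        _ ≤ ENNReal.ofReal A * CE := by gcongr
    -- (ii) the cubic term
    have b2 : ENNReal.ofReal (∫ x, ‖fderiv ℝ φ x‖ * ‖u t x‖ ^ 3) ≤
        ENNReal.ofReal B * (c * (1 + D)) := by
      calc ENNReal.ofReal (∫ x, ‖fderiv ℝ φ x‖ * ‖u t x‖ ^ 3)
          ≤ ∫⁻ x, ENNReal.ofReal (‖fderiv ℝ φ x‖ * ‖u t x‖ ^ 3) :=
            ofReal_integral_le_lintegral_ofReal
              (fun x => mul_nonneg (norm_nonneg _) (pow_nonneg (norm_nonneg _) _))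
              (hDφ.norm.mul (hu.norm.pow 3)).aestronglyMeasurable
        _ ≤ ∫⁻ x, ENNReal.ofReal B * ‖u t x‖ₑ ^ (3 : ℕ) := by
            refine lintegral_mono fun x => ?_
            rw [ENNReal.ofReal_mul (norm_nonneg _), ← ofReal_norm,
              ← ENNReal.ofReal_pow (norm_nonneg _)]
            exact mul_le_mul' (ENNReal.ofReal_le_ofReal (hB x)) le_rfl
        _ = ENNReal.ofReal B * ∫⁻ x, ‖u t x‖ₑ ^ (3 : ℕ) :=
            lintegral_const_mul' _ _ ENNReal.ofReal_ne_top
        _ ≤ ENNReal.ofReal B * (c * (1 + D)) := by gcongr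
    -- (iii) the pressure term, after Young
    have b3 : ENNReal.ofReal (∫ x, |p t x - c₀| * ‖fderiv ℝ φ x‖ * ‖u t x‖) ≤
        ENNReal.ofReal B * ((C₀ + 1) * (c * (1 + D))) := by
      have hmeas : Measurable fun x => ‖p t x - c₀‖ₑ ^ (3 / 2 : ℝ) :=
        (hpc.sub continuous_const).measurable.enorm.pow_const _
      calc ENNReal.ofReal (∫ x, |p t x - c₀| * ‖fderiv ℝ φ x‖ * ‖u t x‖)
          ≤ ∫⁻ x, ENNReal.ofReal (|p t x - c₀| * ‖fderiv ℝ φ x‖ * ‖u t x‖) :=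
            ofReal_integral_le_lintegral_ofReal
              (fun x => mul_nonneg (mul_nonneg (abs_nonneg _) (norm_nonneg _)) (norm_nonneg _))
              (((continuous_abs.comp (hpc.sub continuous_const)).mul hDφ.norm).mul
                hu.norm).aestronglyMeasurable
        _ ≤ ∫⁻ x, ENNReal.ofReal B * (‖p t x - c₀‖ₑ ^ (3 / 2 : ℝ) + ‖u t x‖ₑ ^ (3 : ℕ)) := by
            refine lintegral_mono fun x => ?_
            have hy := young _ _ (abs_nonneg (p t x - c₀)) (norm_nonneg (u t x))
            have hle : |p t x - c₀| * ‖fderiv ℝ φ x‖ * ‖u t x‖ ≤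
                B * (|p t x - c₀| ^ (3 / 2 : ℝ) + ‖u t x‖ ^ 3) := by
              calc |p t x - c₀| * ‖fderiv ℝ φ x‖ * ‖u t x‖
                  = ‖fderiv ℝ φ x‖ * (|p t x - c₀| * ‖u t x‖) := by ring
                _ ≤ B * (|p t x - c₀| ^ (3 / 2 : ℝ) + ‖u t x‖ ^ 3) :=
                    mul_le_mul (hB x) hy (mul_nonneg (abs_nonneg _) (norm_nonneg _)) hB0
            refine (ENNReal.ofReal_le_ofReal hle).trans (le_of_eq ?_)
            rw [ENNReal.ofReal_mul hB0, ENNReal.ofReal_add (Real.rpow_nonneg (abs_nonneg _) _)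
              (pow_nonneg (norm_nonneg _) 3), ← ENNReal.ofReal_rpow_of_nonneg (abs_nonneg _)
              (by norm_num : (0 : ℝ) ≤ 3 / 2), ← Real.enorm_eq_ofReal_abs,
              ENNReal.ofReal_pow (norm_nonneg _), ofReal_norm]
        _ = ENNReal.ofReal B * ((∫⁻ x, ‖p t x - c₀‖ₑ ^ (3 / 2 : ℝ)) +
              ∫⁻ x, ‖u t x‖ₑ ^ (3 : ℕ)) := by
            rw [lintegral_const_mul' _ _ ENNReal.ofReal_ne_top, lintegral_add_left hmeas]
        _ ≤ ENNReal.ofReal B * (C₀ * (c * (1 + D)) + c * (1 + D)) := by gcongr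
        _ = ENNReal.ofReal B * ((C₀ + 1) * (c * (1 + D))) := by rw [add_mul, one_mul]
    -- assemble
    have hab := abs_integral_flux_le hcl' hφ hφc htI c₀
    have hnn1 : 0 ≤ |ν| * ∫ x, |(Δ φ) x| * ‖u t x‖ ^ 2 :=
      mul_nonneg (abs_nonneg ν) (integral_nonneg fun x => by positivity)
    have hnn2 : 0 ≤ ∫ x, ‖fderiv ℝ φ x‖ * ‖u t x‖ ^ 3 := integral_nonneg fun x => by positivity
    have hnn3 : 0 ≤ ∫ x, |p t x - c₀| * ‖fderiv ℝ φ x‖ * ‖u t x‖ :=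
      integral_nonneg fun x => by positivity
    rw [Real.enorm_eq_ofReal_abs]
    calc ENNReal.ofReal |∫ x, (ν * ((Δ φ) x * ‖u t x‖ ^ 2) + fderiv ℝ φ x (u t x) * ‖u t x‖ ^ 2 +
            2 * (p t x * fderiv ℝ φ x (u t x)))|
        ≤ ENNReal.ofReal (|ν| * (∫ x, |(Δ φ) x| * ‖u t x‖ ^ 2) +
            (∫ x, ‖fderiv ℝ φ x‖ * ‖u t x‖ ^ 3) +
            2 * ∫ x, |p t x - c₀| * ‖fderiv ℝ φ x‖ * ‖u t x‖) := ENNReal.ofReal_le_ofReal hab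
      _ = ENNReal.ofReal (|ν| * ∫ x, |(Δ φ) x| * ‖u t x‖ ^ 2) +
            ENNReal.ofReal (∫ x, ‖fderiv ℝ φ x‖ * ‖u t x‖ ^ 3) +
            2 * ENNReal.ofReal (∫ x, |p t x - c₀| * ‖fderiv ℝ φ x‖ * ‖u t x‖) := by
          rw [ENNReal.ofReal_add (add_nonneg hnn1 hnn2) (by positivity),
            ENNReal.ofReal_add hnn1 hnn2, ENNReal.ofReal_mul (by norm_num : (0:ℝ) ≤ 2),
            ENNReal.ofReal_ofNat]
      _ ≤ ENNReal.ofReal A * K₁ + ENNReal.ofReal B * (c * (1 + D)) +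
            2 * (ENNReal.ofReal B * ((C₀ + 1) * (c * (1 + D)))) := by gcongr
      _ = ENNReal.ofReal A * K₁ + ENNReal.ofReal B * (K₂ * (1 + D)) := by rw [hK₂]; ring
  -- integrate the bound over `(0, T)` (no `calc`: restating the integrand is costly to elaborate)
  refine le_trans (lintegral_mono_ae hpt) ?_
  rw [lintegral_add_left measurable_const, setLIntegral_const, hV,
    lintegral_const_mul' _ _ ENNReal.ofReal_ne_top, lintegral_const_mul' _ _ hK₂t,
    lintegral_add_left measurable_const, setLIntegral_const, hV, one_mul, hDD, add_mul, mul_assoc]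
  exact add_le_add (mul_le_mul' le_rfl le_self_add) (mul_le_mul' le_rfl le_add_self)

/-! ### A dilated cut-off family -/

/-- **Dilated smooth cut-offs.** There are `χ : ℝ → (ℝ³ → ℝ)` and constants `A₁, B₁ ≥ 0` such that
for every `R > 0`: `χ_R ∈ C_c^∞`, `0 ≤ χ_R ≤ 1`, `χ_R = 1` on `‖x‖ ≤ R`, `χ_R = 0` on `‖x‖ ≥ 2R`,
`|Δχ_R| ≤ A₁/R²` and `‖Dχ_R‖ ≤ B₁/R` (the bump `χ₁` with radii `1 < 2` about `0`, dilated: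
`χ_R(x) = χ₁(x/R)`). [folklore] -/
theorem exists_cutoffFamily :
    ∃ (χ : ℝ → EuclideanSpace ℝ (Fin 3) → ℝ) (A₁ B₁ : ℝ), 0 ≤ A₁ ∧ 0 ≤ B₁ ∧ ∀ R : ℝ, 0 < R →
      ContDiff ℝ ∞ (χ R) ∧ HasCompactSupport (χ R) ∧ (∀ x, 0 ≤ χ R x) ∧ (∀ x, χ R x ≤ 1) ∧
      (∀ x, ‖x‖ ≤ R → χ R x = 1) ∧ (∀ x, 2 * R ≤ ‖x‖ → χ R x = 0) ∧
      (∀ x, |(Δ (χ R)) x| ≤ A₁ / R ^ 2) ∧ (∀ x, ‖fderiv ℝ (χ R) x‖ ≤ B₁ / R) := by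
  let b : ContDiffBump (0 : EuclideanSpace ℝ (Fin 3)) := ⟨1, 2, one_pos, one_lt_two⟩
  set φ₁ : EuclideanSpace ℝ (Fin 3) → ℝ := fun x => b x with hφ₁def
  have hφ₁ : ContDiff ℝ ∞ φ₁ := b.contDiff
  have hφ₁c : HasCompactSupport φ₁ := b.hasCompactSupport
  have hφ₁2 : ContDiff ℝ 2 φ₁ := hφ₁.of_le (by norm_cast)
  have hφ₁1 : ContDiff ℝ 1 φ₁ := hφ₁.of_le (by norm_cast)
  have hΔc : HasCompactSupport (Δ φ₁) :=
    HasCompactSupport.intro hφ₁c fun x hx => laplacian_eq_zero_of_notMem_tsupport hx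
  obtain ⟨A₁, hA₁⟩ := (continuous_laplacian hφ₁2).bounded_above_of_compact_support hΔc
  obtain ⟨B₁, hB₁⟩ :=
    (hφ₁1.continuous_fderiv one_ne_zero).bounded_above_of_compact_support (hφ₁c.fderiv (𝕜 := ℝ))
  have hA₁0 : 0 ≤ A₁ := (norm_nonneg _).trans (hA₁ 0)
  have hB₁0 : 0 ≤ B₁ := (norm_nonneg _).trans (hB₁ 0)
  refine ⟨fun R x => φ₁ (R⁻¹ • x), A₁, B₁, hA₁0, hB₁0, fun R hR => ⟨?_, ?_, ?_, ?_, ?_, ?_, ?_, ?_⟩⟩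
  · exact hφ₁.comp (contDiff_id.const_smul R⁻¹)
  · refine HasCompactSupport.intro (isCompact_closedBall (0 : EuclideanSpace ℝ (Fin 3)) (2 * R))
      fun x hx => ?_
    rw [mem_closedBall, dist_zero_right, not_le] at hx
    refine b.zero_of_le_dist ?_
    rw [dist_zero_right, norm_smul, Real.norm_eq_abs, abs_of_pos (inv_pos.2 hR)]
    rw [show b.rOut = 2 from rfl, le_inv_mul_iff₀ hR]
    linarith
  · exact fun x => b.nonneg
  · exact fun x => b.le_one
  · intro x hx
    refine b.one_of_mem_closedBall ?_
    rw [mem_closedBall, dist_zero_right, norm_smul, Real.norm_eq_abs, abs_of_pos (inv_pos.2 hR),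
      show b.rIn = 1 from rfl, inv_mul_le_iff₀ hR]
    linarith
  · intro x hx
    refine b.zero_of_le_dist ?_
    rw [dist_zero_right, norm_smul, Real.norm_eq_abs, abs_of_pos (inv_pos.2 hR),
      show b.rOut = 2 from rfl, le_inv_mul_iff₀ hR]
    linarith
  · intro x
    have e : (fun w : EuclideanSpace ℝ (Fin 3) => φ₁ (R⁻¹ • w)) =
        fun w => (1 : ℝ) • φ₁ (R⁻¹ • w) := by
      funext w; rw [one_smul]
    show |(Δ (fun w : EuclideanSpace ℝ (Fin 3) => φ₁ (R⁻¹ • w))) x| ≤ A₁ / R ^ 2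
    rw [e, laplacian_const_smul_comp_smul φ₁ 1 (inv_ne_zero hR.ne') x, smul_eq_mul, one_mul,
      abs_mul, abs_of_nonneg (sq_nonneg _), inv_pow, div_eq_mul_inv, mul_comm (A₁)]
    exact mul_le_mul_of_nonneg_left ((Real.norm_eq_abs _).symm.trans_le (hA₁ _))
      (inv_nonneg.2 (sq_nonneg _))
  · intro x
    show ‖fderiv ℝ (fun w : EuclideanSpace ℝ (Fin 3) => φ₁ (R⁻¹ • w)) x‖ ≤ B₁ / R
    have hd : HasFDerivAt (fun w : EuclideanSpace ℝ (Fin 3) => φ₁ (R⁻¹ • w))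
        ((fderiv ℝ φ₁ (R⁻¹ • x)).comp
          (R⁻¹ • ContinuousLinearMap.id ℝ (EuclideanSpace ℝ (Fin 3)))) x :=
      ((hφ₁1.differentiable (by norm_num)) _).hasFDerivAt.comp x ((hasFDerivAt_id x).const_smul R⁻¹)
    rw [hd.fderiv]
    calc ‖(fderiv ℝ φ₁ (R⁻¹ • x)).comp (R⁻¹ • ContinuousLinearMap.id ℝ (EuclideanSpace ℝ (Fin 3)))‖
        ≤ ‖fderiv ℝ φ₁ (R⁻¹ • x)‖ * ‖R⁻¹ • ContinuousLinearMap.id ℝ (EuclideanSpace ℝ (Fin 3))‖ :=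
          ContinuousLinearMap.opNorm_comp_le _ _
      _ ≤ B₁ * R⁻¹ := by
          refine mul_le_mul (hB₁ _) ?_ (norm_nonneg _) hB₁0
          rw [norm_smul, Real.norm_eq_abs, abs_of_pos (inv_pos.2 hR)]
          exact mul_le_of_le_one_right (inv_nonneg.2 hR.le) ContinuousLinearMap.norm_id_le
      _ = B₁ / R := (div_eq_mul_inv _ _).symm

end Summit.NavierStokesRegularity.NavierStokesRegularity.Theorems.NoTerminalJolt

end
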